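import Summits.AtomisticToContinuum.HydrodynamicLimit.Theorems.InformationPercolationEnginePercolationClosesChaosCesaroTelescoping
import Literature.Analysis.FluidPDE.HardSpherePhaseSpaceProofs
import Mathlib.NumberTheory.DiophantineApproximation.Basic
import HarnessLib

/-!
# Local equilibrium S5 of the line `equilibrium-forecast-chain-rule` (crux `InformationPercolationEngine.PercolationClosesChaos`,
stmt-AtomisticToContinuum-15178) — piece V: the neighbourhood indicator has INFINITE support (audit certificate)

Support file (`--supports stmt-AtomisticToContinuum-15178`) of the registered stub
`stub_cesaroLocalEquilibrium : PredictableProjection → MesoConditionalEquidistribution → LocalCountUI →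
NoMesoscopicOscillation → CoarseLocalMaxwellianity` (worker S5 of lead c3). S5 takes the unit-fraction of INHOMOGENEOUS cells from
part (ii) of `NoMesoscopicOscillation`, whose integrand is the unit average of
`q ↦ 𝟙{(nbhd … q).Nonempty ∧ ϑ < inhom …}` summed by `∑' q : Cell` over ALL of `ℤ³`. This file is the machine-checked form of the
S5 audit finding (γ): that family is `1` on an INFINITE set of cells whenever `ϑ < 1`, hence not summable, its `tsum` is the junk `0`,
and the (ii)-integrand VANISHES IDENTICALLY — part (ii) as typed is vacuous for every `ϑ < 1` and must be re-typed with the guard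
"`q` is an actual kinetic cell" (`∃ x, cellOf c σ N x = q`).

* `euclidDist_cellCentre_shift_le` — shifting a cell index by `K` along `e₀` moves its (wrapped) centre by at most `|K h − j|` for
  every integer `j` (`proj` kills lattice vectors);
* `exists_shift_nbhd_nonempty` — Dirichlet's approximation theorem (`Real.exists_int_int_abs_mul_sub_le`): for every `m ≥ 1` there
  is `K ≥ m` with `‖K h‖_{ℝ/ℤ} ≤ 4h`, so the cell `q + K e₀` has the population of `q` in its `4h`-neighbourhood;
* `infinite_setOf_nbhd_nonempty` — hence `{q | nbhd q ≠ ∅}` is infinite for every configuration;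
* `inhom_eq_one_of_not_mem` — off the finite box a cell is empty and `inhom ϑs w ∅ (nbhd q) = 1` when the neighbourhood is populated;
* `unitAvg_nbhd_inhom_eq_zero` (registered helper, the headline) — for `0 < ϑs`, `ϑ < 1`, `0 < h`: the unit average of the
  (ii)-indicator is `0` for every flow, horizon, phase point;
* `lintegral_nbhd_inhom_eq_zero` — so the (ii)-inequality holds with left-hand side `0` under ANY law.
-/

noncomputable section

open MeasureTheory Set Filter Topology
open scoped ENNReal BigOperators Classical
open Literature.Analysis.FluidPDE Literature.MathematicalPhysics.KineticTheory
open Literature.MathematicalPhysics.KineticTheory.VelocityBlindPlacement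

namespace Summit.AtomisticToContinuum.HydrodynamicLimit.Theorems.EquilibriumForecastLine

/-! ## Wrapped cell centres come back -/

/-- **Shifting a cell index by `K` along `e₀` moves its wrapped centre by at most `|K h − j|`, for every integer `j`.** [folklore] -/
theorem euclidDist_cellCentre_shift_le (c σ : ℝ) (N : ℕ) (q : Cell) (K j : ℤ) :
    Torus.euclidDist (cellCentre c σ N (fun m => if m = 0 then q m + K else q m)) (cellCentre c σ N q) ≤
      |(K : ℝ) * (c * meanFreePath σ N) - j| := by
  set h := c * meanFreePath σ N with hh
  set x : EuclideanSpace ℝ (Fin 3) := WithLp.toLp 2 fun m : Fin 3 => (((q m : ℤ) : ℝ) + 2⁻¹) * h with hx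
  set x' : EuclideanSpace ℝ (Fin 3) :=
    WithLp.toLp 2 fun m : Fin 3 => ((((if m = 0 then q m + K else q m : ℤ)) : ℝ) + 2⁻¹) * h with hx'
  set k : Fin 3 → ℤ := fun m => if m = 0 then -j else 0 with hk
  have hcq : cellCentre c σ N q = Literature.Analysis.FunctionSpaces.Torus.proj x := rfl
  have hcq' : cellCentre c σ N (fun m => if m = 0 then q m + K else q m) =
      Literature.Analysis.FunctionSpaces.Torus.proj (x' + Literature.Analysis.FunctionSpaces.Torus.latticeVec k) := by
    rw [Literature.Analysis.FunctionSpaces.Torus.proj_add_latticeVec]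
    rfl
  have hdiff : ∀ m : Fin 3, (x' + Literature.Analysis.FunctionSpaces.Torus.latticeVec k - x) m =
      if m = 0 then (K : ℝ) * h - j else 0 := by
    intro m
    simp only [hx, hx', PiLp.sub_apply, PiLp.add_apply, Literature.Analysis.FunctionSpaces.Torus.latticeVec_apply, hk]
    by_cases hm : m = 0
    · subst hm
      simp only [if_true]
      push_cast
      ring
    · simp only [if_neg hm]
      push_cast
      ring
  have hnorm : ‖x' + Literature.Analysis.FunctionSpaces.Torus.latticeVec k - x‖ = |(K : ℝ) * h - j| := by
    have h10 : (1 : Fin 3) ≠ 0 := by decide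
    have h20 : (2 : Fin 3) ≠ 0 := by decide
    rw [EuclideanSpace.norm_eq, Fin.sum_univ_three, hdiff 0, hdiff 1, hdiff 2, if_pos rfl, if_neg h10, if_neg h20,
      Real.norm_eq_abs, norm_zero]
    simp only [ne_eq, OfNat.ofNat_ne_zero, not_false_eq_true, zero_pow, add_zero, sq_abs]
    exact Real.sqrt_sq_eq_abs _
  rw [hcq, hcq']
  refine (Torus.euclidDist_proj_le_norm_sub_holds _ _).trans ?_
  rw [hnorm]

/-- **Dirichlet**: for `h > 0` and every `m ≥ 1` there are integers `K ≥ m` and `j` with `|K h − j| ≤ 4h`. [folklore] -/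
theorem exists_int_ge_abs_mul_sub_le {h : ℝ} (hh : 0 < h) (m : ℕ) (hm : 1 ≤ m) :
    ∃ K j : ℤ, (m : ℤ) ≤ K ∧ |(K : ℝ) * h - j| ≤ 4 * h := by
  set n : ℕ := ⌈(m : ℝ) / (4 * h)⌉₊ with hn
  have hmpos : (0 : ℝ) < m := by exact_mod_cast hm
  have hnpos : 0 < n := Nat.ceil_pos.2 (by positivity)
  obtain ⟨j, k, hk0, -, hjk⟩ := Real.exists_int_int_abs_mul_sub_le h hnpos
  have hn1 : (m : ℝ) / (4 * h) < (n : ℝ) + 1 := (Nat.le_ceil _).trans_lt (by rw [hn]; exact lt_add_one _)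
  have hbound : 1 / ((n : ℝ) + 1) ≤ 4 * h / m := by
    rw [div_le_div_iff₀ (by positivity) hmpos]
    rw [div_lt_iff₀ (by positivity)] at hn1
    linarith
  refine ⟨(m : ℤ) * k, (m : ℤ) * j, ?_, ?_⟩
  · have : (1 : ℤ) ≤ k := hk0
    nlinarith
  · have h1 : |((m : ℤ) * k : ℤ) * h - ((m : ℤ) * j : ℤ)| = (m : ℝ) * |(k : ℝ) * h - j| := by
      push_cast
      rw [show (m : ℝ) * k * h - m * j = m * (k * h - j) by ring, abs_mul, abs_of_pos hmpos]
    rw [h1]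
    calc (m : ℝ) * |(k : ℝ) * h - j| ≤ m * (4 * h / m) := by
          exact mul_le_mul_of_nonneg_left (hjk.trans hbound) hmpos.le
      _ = 4 * h := by field_simp

/-- For every configuration, cell `q` and `m ≥ 1` there is a shift `K ≥ m` such that the population of `q` lies in the
`4h`-neighbourhood of the shifted cell. [folklore] -/
theorem exists_shift_nbhd_nonempty {c σ : ℝ} {N : ℕ} (hh : 0 < c * meanFreePath σ N) (w : Phase N) (i : Fin (N + 1))
    (m : ℕ) (hm : 1 ≤ m) :
    ∃ K : ℤ, (m : ℤ) ≤ K ∧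
      i ∈ nbhd c σ N w (fun m' => if m' = 0 then cellOf c σ N (w i).1 m' + K else cellOf c σ N (w i).1 m') := by
  obtain ⟨K, j, hK, hKj⟩ := exists_int_ge_abs_mul_sub_le hh m hm
  refine ⟨K, hK, ?_⟩
  simp only [nbhd, Finset.mem_filter, Finset.mem_univ, true_and]
  rw [Torus.euclidDist_comm]
  exact (euclidDist_cellCentre_shift_le c σ N _ K j).trans hKj

/-- **The set of cells with a nonempty `4h`-neighbourhood is infinite**, for every configuration of `N + 1 ≥ 1` spheres.
[folklore] -/
theorem infinite_setOf_nbhd_nonempty {c σ : ℝ} {N : ℕ} (hh : 0 < c * meanFreePath σ N) (w : Phase N) :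
    {q : Cell | (nbhd c σ N w q).Nonempty}.Infinite := by
  intro hfin
  set q₀ : Cell := cellOf c σ N (w 0).1 with hq₀
  obtain ⟨M, hM⟩ := (hfin.image fun q : Cell => q 0).bddAbove
  set m : ℕ := (M - q₀ 0).toNat + 1 with hmdef
  obtain ⟨K, hK, hmem⟩ := exists_shift_nbhd_nonempty hh w 0 m (by omega)
  have hin : (fun m' => if m' = 0 then q₀ m' + K else q₀ m') ∈ {q : Cell | (nbhd c σ N w q).Nonempty} := ⟨0, hmem⟩
  have hle := hM (Set.mem_image_of_mem (fun q : Cell => q 0) hin)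
  simp only [if_true] at hle
  have h1 : (M - q₀ 0) ≤ ((M - q₀ 0).toNat : ℤ) := Int.self_le_toNat _
  omega

/-! ## Off the box the indicator is `1` -/

/-- Off the finite box a cell is empty, so its inhomogeneity against a POPULATED neighbourhood is `∫ kde(nbhd) = 1` (`ϑs ≠ 0`).
[folklore] -/
theorem inhom_eq_one_of_not_mem {c σ : ℝ} {N : ℕ} (hh : 0 < c * meanFreePath σ N) {ϑs : ℝ} (hϑs : ϑs ≠ 0) (w : Phase N)
    {q : Cell} (hq : q ∉ cellBox (c * meanFreePath σ N)) (hne : (nbhd c σ N w q).Nonempty) :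
    inhom ϑs w (pop c σ N w q) (nbhd c σ N w q) = 1 := by
  rw [pop_eq_empty_of_not_mem hh w hq]
  unfold inhom
  have h1 : ∀ v, |kde ϑs w ∅ v - kde ϑs w (nbhd c σ N w q) v| = kde ϑs w (nbhd c σ N w q) v := by
    intro v
    rw [kde_empty_eq, zero_sub, abs_neg, abs_of_nonneg]
    exact kde_nonneg _ (fun i => (w i).2) ϑs v
  simp_rw [h1]
  exact integral_kde_eq_one hne (fun i => (w i).2) hϑs

/-- The (ii)-indicator family of a configuration is NOT summable over `ℤ³` when `ϑ < 1`. [folklore] -/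
theorem not_summable_nbhd_inhom {c σ : ℝ} {N : ℕ} (hh : 0 < c * meanFreePath σ N) {ϑs ϑ : ℝ} (hϑs : 0 < ϑs) (hϑ : ϑ < 1)
    (w : Phase N) :
    ¬ Summable fun q : Cell =>
      (if (nbhd c σ N w q).Nonempty ∧ ϑ < inhom ϑs w (pop c σ N w q) (nbhd c σ N w q) then (1 : ℝ) else 0) := by
  intro hs
  have hT : ({q : Cell | (nbhd c σ N w q).Nonempty} \ (cellBox (c * meanFreePath σ N) : Set Cell)).Infinite :=
    (infinite_setOf_nbhd_nonempty hh w).sdiff (Finset.finite_toSet _)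
  have hev := hs.tendsto_cofinite_zero.eventually (gt_mem_nhds (by norm_num : (0 : ℝ) < 1 / 2))
  rw [Filter.eventually_cofinite] at hev
  refine hT.mono (fun q hq => ?_) |>.not_finite hev
  -- on `T` the indicator is `1`, which is not `< 1/2`
  obtain ⟨hne, hbox⟩ := hq
  have hbox' : q ∉ cellBox (c * meanFreePath σ N) := fun h => hbox (Finset.mem_coe.2 h)
  have hval : (if (nbhd c σ N w q).Nonempty ∧ ϑ < inhom ϑs w (pop c σ N w q) (nbhd c σ N w q) then (1 : ℝ) else 0) = 1 := by
    rw [if_pos ⟨hne, by rw [inhom_eq_one_of_not_mem hh hϑs.ne' w hbox' hne]; exact hϑ⟩]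
  simp only [Set.mem_setOf_eq, hval]
  norm_num

/-- **Registered helper `unitAvg_nbhd_inhom_eq_zero` (audit certificate, finding (γ) of the S5 audit): part (ii) of
`NoMesoscopicOscillation` is VACUOUS as typed.** For `0 < ϑs`, `ϑ < 1` and a positive cell size, the unit average of the
indicator `𝟙{(nbhd … q).Nonempty ∧ ϑ < inhom …}` is `0` for every flow, horizon and phase point: the family is `1` on the infinitely
many out-of-box cells whose wrapped centre returns next to a sphere (Dirichlet), so it is not summable and `∑' = 0`. [folklore] -/
theorem unitAvg_nbhd_inhom_eq_zero : ∀ {σ : ℝ} {N : ℕ} (Φ : Flow σ N) (ϑs ϑ c τ : ℝ) (z : Phase N), 0 < ϑs → ϑ < 1 → 0 < c * meanFreePath σ N → unitAvg c σ N τ (fun k q => if (nbhd c σ N (Φ.flow ((k : ℝ) * stepLen c σ N) z) q).Nonempty ∧ ϑ < inhom ϑs (Φ.flow ((k : ℝ) * stepLen c σ N) z) (pop c σ N (Φ.flow ((k : ℝ) * stepLen c σ N) z) q) (nbhd c σ N (Φ.flow ((k : ℝ) * stepLen c σ N) z) q) then 1 else 0) = 0 := by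
  intro σ N Φ ϑs ϑ c τ z hϑs hϑ hh
  unfold unitAvg
  have h0 : ∀ k, (∑' q : Cell, (if (nbhd c σ N (Φ.flow ((k : ℝ) * stepLen c σ N) z) q).Nonempty ∧
      ϑ < inhom ϑs (Φ.flow ((k : ℝ) * stepLen c σ N) z) (pop c σ N (Φ.flow ((k : ℝ) * stepLen c σ N) z) q)
        (nbhd c σ N (Φ.flow ((k : ℝ) * stepLen c σ N) z) q) then (1 : ℝ) else 0)) = 0 :=
    fun k => tsum_eq_zero_of_not_summable (not_summable_nbhd_inhom hh hϑs hϑ _)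
  simp only [h0, Finset.sum_const_zero, mul_zero]

/-- Hence the (ii)-inequality of `NoMesoscopicOscillation` holds with left-hand side `0` under ANY law, for every `ϑ < 1`.
[folklore] -/
theorem lintegral_nbhd_inhom_eq_zero {σ : ℝ} {N : ℕ} (Φ : Flow σ N) {ϑs ϑ c : ℝ} (τ : ℝ) (μ : Measure (Phase N))
    (hϑs : 0 < ϑs) (hϑ : ϑ < 1) (hh : 0 < c * meanFreePath σ N) :
    ∫⁻ z, ENNReal.ofReal (unitAvg c σ N τ fun k q =>
        if (nbhd c σ N (Φ.flow ((k : ℝ) * stepLen c σ N) z) q).Nonempty ∧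
            ϑ < inhom ϑs (Φ.flow ((k : ℝ) * stepLen c σ N) z)
              (pop c σ N (Φ.flow ((k : ℝ) * stepLen c σ N) z) q)
              (nbhd c σ N (Φ.flow ((k : ℝ) * stepLen c σ N) z) q) then 1 else 0) ∂μ = 0 := by
  simp only [unitAvg_nbhd_inhom_eq_zero Φ ϑs ϑ c τ _ hϑs hϑ hh, ENNReal.ofReal_zero, lintegral_zero]

end Summit.AtomisticToContinuum.HydrodynamicLimit.Theorems.EquilibriumForecastLine

end
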